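import Summits.ABC.ABC.Theorems.DefiniteXiSteinbergCoreXiDegreeComparisonPrime
import Summits.ABC.ABC.Theorems.DefiniteXiSteinbergCoreXiDegreeComparison
import Summits.ABC.ABC.Theorems.DefiniteXiXiStrongBoundItemsCalibration
import HarnessLib

/-!
# Crux `SteinbergCore` (stmt-ABC-15024), route DefiniteXi, line `p6_tamagawa_split` — child 1
# (`stub_xiDegreeComparison`, the `ξ`-versus-degree comparison away from `6`) REWIRED over ROUTE ITEMS

The line `p6_tamagawa_split` splits the crux `B = SteinbergCore`
(`cps ξ(E; N/Nm, Nm) · T(E) ≤ C_ε N^(2+ε)` on the Frey curves `E = freyCurve a b`; `ξ = brandtXi`,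
`cps n = n / (2^{v₂ n} 3^{v₃ n})`, `T(E) = ∏_{q ∣ N} v_q(Δ_min E)`) as (comparison `ξ`-vs-degree) ×
(degree conjecture away from `6`) × (valuation-product milestone), glue `steinbergCore_of_subs` (p137293).
Child 1 — `cps ξ(N/Nm; Nm) ≤ C_ε N^ε · cps (deg D) · T³` for a datum `D` of minimal degree of the Frey
model — is KNOWN IN PRINT (Takahashi 2001 Thm. 2.3; Ribet–Takahashi 1997 Thm. 2 = Pasten 2024 Prop. 6.13;
Pasten 2024 Lemma 6.8; Jacquet–Langlands) and already landed CONDITIONALLY on named facts: at prime type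
`Nm = q` as `xiDegreeComparison_prime_of_facts` (p137891, hypotheses `takahashi2001_thm_2_3_of_coprime`,
`PastenShimura2024_minimalDegree_le_163_mul`, `PastenShimura2024_lemma_6_8`, `FreyModularity`) and at
EVERY admissible `Nm` as `xiDegreeComparison_of_facts` (p139336, hypotheses `hTlev` / `hT2` = Takahashi
2001 Thm. 2.3 for the Shimura curves `X₀^D(M)` on the level / discriminant side, `PastenShimura2024_lemma_6_8`,
`nonempty_shimuraParametrizationData`, `FreyModularity`).

Two of those Literature facts have since been PROMOTED to route items whose bodies repeat them verbatim:
`MazurKenkuBound` (stmt-ABC-15125) `= PastenShimura2024_minimalDegree_le_163_mul` and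
`IsogenyValuationTransport` (stmt-ABC-18928) `= PastenShimura2024_lemma_6_8` (tree lemmas
`DefiniteXiXiStrongBoundItemsCalibration.mazurKenkuBound_iff` / `….isogenyValuationTransport_iff`, both
`Iff.rfl`).  This file restates child 1 over those ROUTE BINDERS (the tree being append-only, as a new
file): after it the residual debt of the stub reads, hypothesis by hypothesis, as route items
(`MazurKenkuBound`, `IsogenyValuationTransport`, `FreyModularity`) plus ONE printed theorem outside the
ledger — Takahashi 2001 Thm. 2.3, as the tree fact `takahashi2001_thm_2_3_of_coprime` (prime type) or in
its unfiled Shimura-curve forms `hTlev` / `hT2` (every admissible `Nm`) — and Jacquet–Langlands data.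

Contents: `xiDegreeComparison_prime_of_items` (prime type over items); section `Takahashi` (hypotheses
`hTlev`, `hT2` verbatim those of `DefiniteXiXiStrongBoundItemsCalibration.lean`):
`xiDegreeComparison_of_items` (the registered stub signature over items); and the arrow form
`stub_xiDegreeComparison_of_items` with every hypothesis explicit.  No new mathematics, no new definition,
no new named fact: the proof terms are those of p137891 / p139336 fed with the items.  Deliberately NOT
here: the Shimura-curve forms `hTlev` / `hT2` are not filed as named facts (lead's call, see the line file).

## References

* [Takahashi2001] S. Takahashi, Degrees of parametrizations of elliptic curves by Shimura curves,
  J. Number Theory 90 (2001) 74–88: Thm. 2.3 (p. 79), Thm. 3.2 (a) (p. 82), p. 84.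
* [PastenShimura2024] H. Pasten, Shimura curves and the abc conjecture, J. Number Theory 254 (2024)
  = arXiv:1705.09251: §3 p. 13, Lemma 6.8 (p. 22), Prop. 6.13 (p. 23), §6.9 (p. 25).
-/

-- `Summit.<Summit>.<Problem>`: for the single-conjunct summit `ABC` the duplicate `ABC.ABC` is mandated (D-0017).
set_option linter.dupNamespace false

noncomputable section
namespace Summit.ABC.ABC.Theorems.XiDegreeComparisonItems

open Summit.ABC.ABC.Theses.DefiniteXi
open Literature.NumberTheory.EllipticCurves Literature.NumberTheory.EllipticCurves.ModularForms
open Literature.NumberTheory.Automorphic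
open Summit.ABC.ABC.Theorems.DefiniteXiXiStrongBoundItemsCalibration

/-! ## (1) Prime type `Nm = q` over items -/

/-- **The `ξ`-versus-degree comparison at prime type over ROUTE ITEMS**: modulo Takahashi 2001 Thm. 2.3
at `r ∥ N` (`takahashi2001_thm_2_3_of_coprime`) and the route items `MazurKenkuBound` (stmt-ABC-15125),
`IsogenyValuationTransport` (stmt-ABC-18928), `FreyModularity`: for every `ε > 0` there is `C` with, for
all coprime `a, b` (`ab(a+b) ≠ 0`), `N` the conductor of `freyCurve a b` and every odd prime `q ∣ N`, a
datum `D` of minimal degree with `cps ξ(N/q; q) ≤ C · N^ε · cps (deg D) · T³` — the landed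
`xiDegreeComparison_prime_of_facts` (p137891) fed with the items through the definitional promotions
`mazurKenkuBound_iff`, `isogenyValuationTransport_iff`.
[cite: Takahashi2001, Thm. 2.3 (p. 79)] [cite: PastenShimura2024, §3 p. 13 and Lemma 6.8 (p. 22)] -/
theorem xiDegreeComparison_prime_of_items
    (hT : Literature.NumberTheory.EllipticCurves.takahashi2001_thm_2_3_of_coprime)
    (hMK : Summit.ABC.ABC.Theses.DefiniteXi.MazurKenkuBound)
    (hIVT : Summit.ABC.ABC.Theses.DefiniteXi.IsogenyValuationTransport)
    (hMod : Summit.ABC.ABC.Theses.DefiniteXi.FreyModularity) :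
    ∀ ε : ℝ, 0 < ε → ∃ C : ℝ, ∀ a b : ℤ, IsCoprime a b → a * b * (a + b) ≠ 0 → ∀ (N : ℕ) [NeZero N],
      (Literature.NumberTheory.EllipticCurves.freyCurve a b).conductorNorm ℤ = N →
      ∀ q : ℕ, q.Prime → q ≠ 2 → q ∣ N →
      Literature.NumberTheory.Automorphic.brandtXi (N / q) q
          (fun n => (Literature.NumberTheory.EllipticCurves.freyCurve a b).LFunction n) ≠ 0 →
      ∃ D : Literature.NumberTheory.EllipticCurves.ModularForms.ModularParametrizationData
        (Literature.NumberTheory.EllipticCurves.freyCurve a b) N,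
        (∀ D' : Literature.NumberTheory.EllipticCurves.ModularForms.ModularParametrizationData
          (Literature.NumberTheory.EllipticCurves.freyCurve a b) N, D.deg ≤ D'.deg) ∧
        ((Literature.NumberTheory.Automorphic.brandtXi (N / q) q
              (fun n => (Literature.NumberTheory.EllipticCurves.freyCurve a b).LFunction n) /
            (ordProj[2] (Literature.NumberTheory.Automorphic.brandtXi (N / q) q
                (fun n => (Literature.NumberTheory.EllipticCurves.freyCurve a b).LFunction n)) *
              ordProj[3] (Literature.NumberTheory.Automorphic.brandtXi (N / q) q
                (fun n => (Literature.NumberTheory.EllipticCurves.freyCurve a b).LFunction n))) : ℕ) : ℝ) ≤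
          C * (N : ℝ) ^ ε * ((D.deg / (ordProj[2] D.deg * ordProj[3] D.deg) : ℕ) : ℝ) *
            ((∏ p ∈ N.primeFactors, ((Literature.NumberTheory.EllipticCurves.freyCurve a b).minimalDiscriminantNorm
              ℤ).factorization p : ℕ) : ℝ) ^ 3 :=
  Summit.ABC.ABC.Theorems.xiDegreeComparison_prime_of_facts hT (mazurKenkuBound_iff.mp hMK)
    (isogenyValuationTransport_iff.mp hIVT) hMod

/-! ## (2) Every admissible `Nm`: section hypotheses `hTlev`, `hT2` (Takahashi 2001 Thm. 2.3 for `X₀^D(M)`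
at `p ∥ M` and at `p ∣ D` with Thm. 3.2 (a) — verbatim those of `DefiniteXiXiStrongBoundItemsCalibration.lean`) -/

section Takahashi

variable
  (hTlev : ∀ {N D M p m : ℕ}, p.Prime → M = p * m → ¬ p ∣ m → IsAdmissibleFactorization N D M →
    ∀ (X : ShimuraCurveData D M) (W : WeierstrassCurve ℚ) [W.IsElliptic], W.conductorNorm ℤ = N →
    ∀ (W' : WeierstrassCurve ℚ) [W'.IsElliptic] (P : ShimuraParametrizationData X W'),
      P.IsMinimalFor W →
    ∀ S : Brandt.XiSetup m (D * p),
      ∃ i j : ℕ, 0 < i ∧ i * j = (W'.minimalDiscriminantNorm ℤ).factorization p ∧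
        i ∣ S.xi (fun n => W'.LFunction n) ∧ P.deg * i = S.xi (fun n => W'.LFunction n) * j)
  (hT2 : ∀ {N D M p d : ℕ}, p.Prime → D = p * d → IsAdmissibleFactorization N D M →
    ∀ (X : ShimuraCurveData D M) (W : WeierstrassCurve ℚ) [W.IsElliptic], W.conductorNorm ℤ = N →
    ∀ (W' : WeierstrassCurve ℚ) [W'.IsElliptic] (P : ShimuraParametrizationData X W'),
      P.IsMinimalFor W →
    ∀ S : Brandt.XiSetup (p * M) d,
      ∃ i j : ℕ, 0 < i ∧ i * j = (W'.minimalDiscriminantNorm ℤ).factorization p ∧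
        i ∣ S.xi (fun n => W'.LFunction n) ∧ P.deg * i = S.xi (fun n => W'.LFunction n) * j)

include hTlev hT2

/-- **The registered stub `stub_xiDegreeComparison` over ROUTE ITEMS** (section form): at EVERY admissible
(odd, squarefree, `ω(Nm)` odd, possibly composite) `Nm ∣ N`, modulo `hTlev`, `hT2`, the route item
`IsogenyValuationTransport` (stmt-ABC-18928), Jacquet–Langlands data and `FreyModularity`, a datum `D` of
minimal degree of the Frey model exists with `cps ξ(N/Nm; Nm) ≤ C_ε N^ε · cps (deg D) · T³` — the landed
`xiDegreeComparison_of_facts` (p139336) fed with the item through `isogenyValuationTransport_iff`.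
[cite: Takahashi2001, Thm. 2.3 (p. 79)] [cite: PastenShimura2024, §3 p. 13 and Lemma 6.8 (p. 22)] -/
theorem xiDegreeComparison_of_items (hIVT : IsogenyValuationTransport)
    (hJL : Literature.NumberTheory.Automorphic.nonempty_shimuraParametrizationData) (hMod : FreyModularity) :
    ∀ ε : ℝ, 0 < ε → ∃ C : ℝ, ∀ a b : ℤ, IsCoprime a b → a * b * (a + b) ≠ 0 → ∀ (N : ℕ) [NeZero N],
      (Literature.NumberTheory.EllipticCurves.freyCurve a b).conductorNorm ℤ = N →
      ∀ Nm : ℕ, Odd Nm → Squarefree Nm → Odd Nm.primeFactors.card → Nm ∣ N →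
      Literature.NumberTheory.Automorphic.brandtXi (N / Nm) Nm
          (fun n => (Literature.NumberTheory.EllipticCurves.freyCurve a b).LFunction n) ≠ 0 →
      ∃ D : Literature.NumberTheory.EllipticCurves.ModularForms.ModularParametrizationData
        (Literature.NumberTheory.EllipticCurves.freyCurve a b) N,
        (∀ D' : Literature.NumberTheory.EllipticCurves.ModularForms.ModularParametrizationData
          (Literature.NumberTheory.EllipticCurves.freyCurve a b) N, D.deg ≤ D'.deg) ∧
        ((Literature.NumberTheory.Automorphic.brandtXi (N / Nm) Nm
              (fun n => (Literature.NumberTheory.EllipticCurves.freyCurve a b).LFunction n) /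
            (ordProj[2] (Literature.NumberTheory.Automorphic.brandtXi (N / Nm) Nm
                (fun n => (Literature.NumberTheory.EllipticCurves.freyCurve a b).LFunction n)) *
              ordProj[3] (Literature.NumberTheory.Automorphic.brandtXi (N / Nm) Nm
                (fun n => (Literature.NumberTheory.EllipticCurves.freyCurve a b).LFunction n))) : ℕ) : ℝ) ≤
          C * (N : ℝ) ^ ε * ((D.deg / (ordProj[2] D.deg * ordProj[3] D.deg) : ℕ) : ℝ) *
            ((∏ q ∈ N.primeFactors, ((Literature.NumberTheory.EllipticCurves.freyCurve a b).minimalDiscriminantNorm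
              ℤ).factorization q : ℕ) : ℝ) ^ 3 :=
  Summit.ABC.ABC.Theorems.xiDegreeComparison_of_facts hTlev hT2 (isogenyValuationTransport_iff.mp hIVT)
    hJL hMod

end Takahashi

/-- **The registered stub `stub_xiDegreeComparison` over ROUTE ITEMS, arrow form** — hypotheses, in order:
Takahashi 2001 Thm. 2.3 for `X₀^D(M)` at `p ∥ M` (`hTlev`) and at `p ∣ D` with Thm. 3.2 (a) (`hT2`), the
route item `IsogenyValuationTransport`, Jacquet–Langlands data (`nonempty_shimuraParametrizationData`), the
route item `FreyModularity`; conclusion verbatim the registered signature, header fully qualified.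
[cite: Takahashi2001, Thm. 2.3 (p. 79)] [cite: PastenShimura2024, §3 p. 13 and Lemma 6.8 (p. 22)] -/
theorem stub_xiDegreeComparison_of_items :
    (∀ {N D M p m : ℕ}, p.Prime → M = p * m → ¬ p ∣ m →
      Literature.NumberTheory.Automorphic.IsAdmissibleFactorization N D M →
      ∀ (X : Literature.NumberTheory.Automorphic.ShimuraCurveData D M) (W : WeierstrassCurve ℚ)
        [W.IsElliptic], W.conductorNorm ℤ = N →
      ∀ (W' : WeierstrassCurve ℚ) [W'.IsElliptic]
        (P : Literature.NumberTheory.Automorphic.ShimuraParametrizationData X W'), P.IsMinimalFor W →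
      ∀ S : Literature.NumberTheory.Automorphic.Brandt.XiSetup m (D * p),
        ∃ i j : ℕ, 0 < i ∧ i * j = (W'.minimalDiscriminantNorm ℤ).factorization p ∧
          i ∣ S.xi (fun n => W'.LFunction n) ∧ P.deg * i = S.xi (fun n => W'.LFunction n) * j) →
    (∀ {N D M p d : ℕ}, p.Prime → D = p * d →
      Literature.NumberTheory.Automorphic.IsAdmissibleFactorization N D M →
      ∀ (X : Literature.NumberTheory.Automorphic.ShimuraCurveData D M) (W : WeierstrassCurve ℚ)
        [W.IsElliptic], W.conductorNorm ℤ = N →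
      ∀ (W' : WeierstrassCurve ℚ) [W'.IsElliptic]
        (P : Literature.NumberTheory.Automorphic.ShimuraParametrizationData X W'), P.IsMinimalFor W →
      ∀ S : Literature.NumberTheory.Automorphic.Brandt.XiSetup (p * M) d,
        ∃ i j : ℕ, 0 < i ∧ i * j = (W'.minimalDiscriminantNorm ℤ).factorization p ∧
          i ∣ S.xi (fun n => W'.LFunction n) ∧ P.deg * i = S.xi (fun n => W'.LFunction n) * j) →
    Summit.ABC.ABC.Theses.DefiniteXi.IsogenyValuationTransport →
    Literature.NumberTheory.Automorphic.nonempty_shimuraParametrizationData →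
    Summit.ABC.ABC.Theses.DefiniteXi.FreyModularity →
    ∀ ε : ℝ, 0 < ε → ∃ C : ℝ, ∀ a b : ℤ, IsCoprime a b → a * b * (a + b) ≠ 0 → ∀ (N : ℕ) [NeZero N],
      (Literature.NumberTheory.EllipticCurves.freyCurve a b).conductorNorm ℤ = N →
      ∀ Nm : ℕ, Odd Nm → Squarefree Nm → Odd Nm.primeFactors.card → Nm ∣ N →
      Literature.NumberTheory.Automorphic.brandtXi (N / Nm) Nm
          (fun n => (Literature.NumberTheory.EllipticCurves.freyCurve a b).LFunction n) ≠ 0 →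
      ∃ D : Literature.NumberTheory.EllipticCurves.ModularForms.ModularParametrizationData
        (Literature.NumberTheory.EllipticCurves.freyCurve a b) N,
        (∀ D' : Literature.NumberTheory.EllipticCurves.ModularForms.ModularParametrizationData
          (Literature.NumberTheory.EllipticCurves.freyCurve a b) N, D.deg ≤ D'.deg) ∧
        ((Literature.NumberTheory.Automorphic.brandtXi (N / Nm) Nm
              (fun n => (Literature.NumberTheory.EllipticCurves.freyCurve a b).LFunction n) /
            (ordProj[2] (Literature.NumberTheory.Automorphic.brandtXi (N / Nm) Nm
                (fun n => (Literature.NumberTheory.EllipticCurves.freyCurve a b).LFunction n)) *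
              ordProj[3] (Literature.NumberTheory.Automorphic.brandtXi (N / Nm) Nm
                (fun n => (Literature.NumberTheory.EllipticCurves.freyCurve a b).LFunction n))) : ℕ) : ℝ) ≤
          C * (N : ℝ) ^ ε * ((D.deg / (ordProj[2] D.deg * ordProj[3] D.deg) : ℕ) : ℝ) *
            ((∏ q ∈ N.primeFactors, ((Literature.NumberTheory.EllipticCurves.freyCurve a b).minimalDiscriminantNorm
              ℤ).factorization q : ℕ) : ℝ) ^ 3 :=
  fun hTlev hT2 hIVT hJL hMod => xiDegreeComparison_of_items hTlev hT2 hIVT hJL hMod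

end Summit.ABC.ABC.Theorems.XiDegreeComparisonItems

end
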